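import Summits.QuantumFields.YangMills.Theorems.BackwardLiouvilleRigidityOneStepBackwardContractionAdmDescentDisintegration
import HarnessLib

/-!
# LINE g25-4 «jensen_collar» v1 — JEN∘ (`JensenGapCan`, row 3 of LINE g25-1 «organ_tangent», SECOND ORDER of the Taylor cut of O1)
# cut into the SMALL-FIELD CUMULANT (SFC∘) + the COLLAR ∕ LARGE-FIELD conditional-mass log-ratio (COLLAR∘)
# (crux stmt-QuantumFields-20520 `FluctuationComparisonRegPrIntL`; package `Lines/runpair_organ.lean` v16 ⟸ … ⟸ O1 ⟸ VER∘ ∧ LIN∘ ∧ JEN∘)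

bears_on: R3:stmt-QuantumFields-20520 [ym-r3-idea-1-g25] · LENS «control» (second variation of the backward step: the centred cumulant
generating function of the localised fibre law is the quadratic controlling quantity; everything the class only bounds from above is
pushed into one conditional-mass log-ratio of floor size).

HONESTY.  Nothing of Bałaban's is asserted here; every row is a `def … : Prop`, both `stub_*` are `sorry`s, and the only kernel-checked
content is the ★ junction `jensenGap_of_collarCut` (and the plug `jensenGap_of_stubs`).  JEN∘, O1, item 20520 and the rung leaf
`…T3YM3TorusStatement.YM3TorusSU2` are NOT proved.  R3 = SU(2) YM₃ on T³ — NOT d = 4, NOT infinite volume, NOT a mass gap, NOT Clay.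
No summit is proved by a line.

THE CUT.  JEN∘ (restated verbatim below as `JensenGapCan`, byte-identical with `OrganTangent.JensenGapCan` of `Lines/organ_tangent.lean`
v2.3; docked there by text identity, never imported) says: in O1's frame, given the window-continuous localised fibre mean `m = E′_χ[h | ·]`
(VER∘) of the fine discrepancy `h = log ρ_{j+1} − log ρ′_{j+1}` with presentation `(c, a, w)` and currency `x = a + Θ_{j+1}w ≤ w₀`, the
Jensen gap `q := (log ρ_j − log ρ′_j) − m` has a 4-point window weight `w′` with `Θ_j w′ ≤ C·x·x + δ_j`.  By the fibre identity
(`FibreLaplace.stub_fibreIdentityAE`: `ρ_j(V) = ∫ ρ_{j+1} dσ_V` a.e., both towers) and `E′_χ[· | V] = ∫ χ · ρ′ dσ_V / ∫ χρ′ dσ_V`,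
a.e. on the window
    `q = q_sf + q_lf`,   `q_sf(V) := log ∫ χρ_{j+1} dσ_V − log ∫ χρ′_{j+1} dσ_V − m(V) = log Ẽ_V[e^{h − m(V)}]`,
    `q_lf(V) := q − q_sf = log E′[χ | V] − log E[χ | V]`,
where `Ẽ_V := χρ′dσ_V / ∫χρ′dσ_V` is the LOCALISED reference fibre law (under which `h − m(V)` is centred — `m` is exactly its mean) and
`E[χ | V]`, `E′[χ | V]` are the conditional SMALL-FIELD PROBABILITIES of the two towers over `V`.  The rows type the two pieces SEPARATELY,
each in JEN∘'s own shape (same frame, same `(c, a, w)`, same conclusion format — a 4-point window weight with `Θ_j w′ ≤ C·x·x + δ_j`):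
* SFC∘ `SmallFieldCumulantCan` — there is a window-continuous version `qs` of `q_sf` (a.e. equal to the `σ`-expression; the natural one is
  `log ∫χρ dλ_V − log ∫χρ′ dλ_V − m(V)` over the regular fibre package `λ` of LINE g25-3 «version_coarea» — the normalisation `φ` cancels in
  the log-difference) whose 4-point weight obeys the QUADRATIC-plus-floor bound.  Mechanism: `q_sf = log Ẽ_V[e^{f}]` with `Ẽ_V f = 0`,
  `f = h − m(V)`, is the centred cumulant generating function at parameter 1: `= ½ Var_Ẽ(f) + O(f³)`; its connected 4-point structure in two
  coarse bonds `b, b′` is a truncated fibre correlation, quadratic in the local size of `f` and exponentially decaying in `dist(b, b′)` by the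
  decay of the small-field fluctuation covariance ([Balaban1985Propagators]) — Brascamp–Lieb ∕ cluster expansion on the convex small-field
  fibre ([Balaban1985UV3] (41)–(47), [Balaban1988RG2] §1); NO large-field object enters (`χ` kills it inside every integral).
* COLLAR∘ `CollarMassCan` — for ANY window-continuous `qs` a.e. equal to the `σ`-expression, the difference `q − qs` (a.e. `= log E′[χ | V] −
  log E[χ | V]`, the log-ratio of the two towers' conditional small-field probabilities) has a 4-point window weight of FLOOR size
  (`Θ_j w′ ≤ C·x·x + δ_j` with the intended `C = 0`): `1 − E[χ | V]` and `1 − E′[χ | V]` are conditional masses of the COLLAR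
  `{θ_{j+1}/2 < max defect < θ_{j+1}}` (Wilson weight `e^{−β_{j+1}θ_{j+1}²/4·(1 − …)}`) and of the LARGE-FIELD region (`Mem.large`, the
  `p₀`-suppression `e^{−p₀(…)}` of [Balaban1985UV3] (47), [Balaban1988LargeField]) — fibrewise, uniformly on the coarse window, for BOTH towers;
  this is where the class's one-sided control off the small-field set is spent, and nowhere else in the Taylor cut.
The ★ junction takes `qs, w₁` from SFC∘, feeds `qs` to COLLAR∘ for `w₂`, and returns `w′ := w₁ + w₂`, `C := Cˢ + Cᶜ`, `δ := δˢ + δᶜ`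
(floor class closed under `+` — proved as in g25-1), `θ₀ := min`, `κ₀ := min`, `γ₁ := min`, `w₀ := min`, `j₁ := max`; the 4-point
inequality for `q = qs + (q − qs)` is the triangle inequality (`abs_add_le`, `ring`).  KT-W is honoured exactly as in JEN∘ (bounds on the
combined currency of a two-CLASS-tower input; nothing Wilson-exact is transported alone); B-8(a): O1's tower block is carried verbatim.

WHY THIS LINE (D-0145 skeleton; LENS «control»).  With g25-3 (VER∘ ⟸ COAREA∘ ∧ PINCH∘) and g25-2 (LIN∘ ⟸ MIN∘ ∧ BGEV∘ ∧ FLUC∘) every row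
of the Taylor cut g25-1 now has its own second layer; this one separates the two estimates of JEN∘ that use DISJOINT parts of Bałaban's
machine — convexity ∕ cluster expansion of the small-field fluctuation integral (SFC∘) versus large-field ∕ collar suppression (COLLAR∘) —
so that they can be staffed, priced and refuted independently (a refutation of COLLAR∘ as typed would say the floor class is too small for
conditional — not total — large-field masses, which is checkable on the class `Mem` alone; a refutation of SFC∘ would be a statement about
cumulants of the small-field measure, checkable in the Gaussian ∕ hierarchical toy).

Rows restated BY TEXT (never imported): `sfCut` (v2.1 body) and JEN∘ `JensenGapCan` (v2.3 file, body unchanged since v2) from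
`Lines/organ_tangent.lean`.  Landed organs: none used in the junction (`FibreLaplace.stub_fibreIdentityAE` justifies the reading of
`q_sf`, `q_lf`; cited, not used).
-/

open MeasureTheory Filter Topology
open Literature.MathematicalPhysics.QuantumFieldTheory.Balaban1983to89 T3ContinuumYM3Torus T3NestedUnitLaws
  T3UnitLawDensityEML T4Continuum BalabanUVClass T3UnitScaleTilt

namespace Summit.QuantumFields.YangMills.Cruxes.FluctuationComparisonRegPrIntL.JensenCollar

noncomputable def sfCut {P : Params} {k : ℕ} (θ : ℝ) (U : GaugeField P k ↥(Matrix.specialUnitaryGroup (Fin 2) ℂ)) : ℝ :=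
  ∏ p : Plaq P k, max 0 (min 1 (3 - 4 * dist1 (GaugeField.plaqHol U p) / θ))


/-- JEN∘ · `JensenGapCan` — restated BY TEXT, byte-identical with `OrganTangent.JensenGapCan` (`Lines/organ_tangent.lean` v2.3; the
row this line serves): the Jensen gap `q = (log ρ_j − log ρ′_j) − m` of the localised fibre mean has a 4-point window weight `w′` with
`Θ_j w′ ≤ C·x·x + δ_j`, in O1's frame, for `κ ≤ κ₀`, `θ ≤ θ₀`. -/
def JensenGapCan : Prop :=
  ∃ γ₁ : ℝ, 0 < γ₁ ∧ ∀ (F : T3Family) (γ : ℝ), 0 < γ → γ ≤ γ₁ → ∀ (b₀ p₀ : ℝ) (j₀ : ℕ) (prm : ℕ → ClassParams) (η : ℕ → ℝ), 0 < b₀ → 0 < p₀ → AdmissibleClassParams F γ b₀ p₀ prm → (∀ j, 0 ≤ η j) → Summable η → Summable (fun i => ∑' k, η (k + i)) → Tendsto (fun j => (∑' k, η (k + j)) * ((1 + 2 * ((F.L : ℝ) ^ j / γ) * (Fintype.card (Plaq (F.P j) 0) : ℝ)) * (Fintype.card (PBond (F.P j) 0) : ℝ) ^ 2)) atTop (𝓝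 0) → ∃ κ₀ : ℝ, 0 < κ₀ ∧ ∀ (κ : ℝ), 0 < κ → κ ≤ κ₀ → ∃ θ₀ : ℝ, 0 < θ₀ ∧ ∀ (θ : ℝ), 0 < θ → θ ≤ θ₀ → ∃ (C w₀ : ℝ) (δ : ℕ → ℝ) (j₁ : ℕ), 0 ≤ C ∧ 0 < w₀ ∧ (∀ j, 0 ≤ δ j) ∧ Summable δ ∧ Summable (fun i => ∑' k, δ (k + i)) ∧ Tendsto (fun j => (∑' k, δ (k + j)) * ((1 + 2 * ((F.L : ℝ) ^ j / γ) * (Fintype.card (Plaq (F.P j) 0) : ℝ)) * (Fintype.card (PBond (F.P j) 0) : ℝ) ^ 2)) atTop (𝓝 0) ∧ j₀ ≤ j₁ ∧ ∀ (T : ℕ), ∀ (μ μ' : ((j : ℕ) → MeasureTheory.Measure (GaugeField (F.P j) 0 ↥(Matrix.specialUnitaryGroup (Fin 2) ℂ)))) (ρ ρ' : ((j : ℕ) → GaugeField (F.P j) 0 ↥(Matrix.specialUnitaryGroup (Fin 2) ℂ) → ℝ)), (∀ j : ℕ, j ≤ T → IsProbabilityMeasure (μ j) ∧ IsProbabilityMeasure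 (μ' j)) → (∀ j : ℕ, j < T → μ j = Measure.map (descend F ℰp j) (μ (j + 1)) ∧ μ' j = Measure.map (descend F ℰp j) (μ' (j + 1))) → (∀ j : ℕ, j₀ ≤ j → j ≤ T → ((∀ U, PlaqSmall (θBal F.L γ b₀ p₀ j) U → 0 < ρ j U ∧ 0 < ρ' j U) ∧ μ j = (fieldMeasure _ _ _).withDensity (fun U => ENNReal.ofReal (ρ j U)) ∧ μ' j = (fieldMeasure _ _ _).withDensity (fun U => ENNReal.ofReal (ρ' j U)) ∧ MemAtHeight F ℰp j (prm j) (ρ j) ∧ MemAtHeight F ℰp j (prm j) (ρ' j) ∧ μ j {U | ¬ PlaqSmall (θBal F.L γ b₀ p₀ j) U} ≤ ENNReal.ofReal (η j) ∧ μ' j {U | ¬ PlaqSmall (θBal F.L γ b₀ p₀ j) U} ≤ ENNReal.ofReal (η j) ∧ (ContinuousOn (ρ j) {U | PlaqSmall (θBal F.L γ b₀ p₀ j) U} ∧ ContinuousOn (ρ' j) {U | PlaqSmall (θBal F.L γ b₀ p₀ j) U}))) → ∀ (j : ℕ), j₁ ≤ j → j + 2 ≤ T → ∀ (σ : ProbabilityTheory.Kernel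 (GaugeField (F.P j) 0 ↥(Matrix.specialUnitaryGroup (Fin 2) ℂ)) (GaugeField (F.P (j + 1)) 0 ↥(Matrix.specialUnitaryGroup (Fin 2) ℂ))), ProbabilityTheory.IsMarkovKernel σ → (Measure.map (descend F ℰp j) (fieldMeasure (F.P (j + 1)) 0 ↥(Matrix.specialUnitaryGroup (Fin 2) ℂ))).bind ⇑σ = fieldMeasure (F.P (j + 1)) 0 ↥(Matrix.specialUnitaryGroup (Fin 2) ℂ) → (∀ᵐ V ∂(Measure.map (descend F ℰp j) (fieldMeasure (F.P (j + 1)) 0 ↥(Matrix.specialUnitaryGroup (Fin 2) ℂ))), ∀ᵐ U ∂(σ V), descend F ℰp j U = V) → ∀ (m : GaugeField (F.P j) 0 ↥(Matrix.specialUnitaryGroup (Fin 2) ℂ) → ℝ), ContinuousOn m {V | PlaqSmall (θBal F.L γ b₀ p₀ j) V} → (∀ᵐ V ∂(fieldMeasure (F.P j) 0 ↥(Matrix.specialUnitaryGroup (Fin 2) ℂ)), PlaqSmall (θBal F.L γ b₀ p₀ j) V → MeasureTheory.Integrable (fun U => sfCut (θBal F.L γ b₀ p₀ (j + 1)) U *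 (Real.log (ρ (j + 1) U) - Real.log (ρ' (j + 1) U)) * ρ' (j + 1) U) (σ V) ∧ m V = (∫ U, sfCut (θBal F.L γ b₀ p₀ (j + 1)) U * (Real.log (ρ (j + 1) U) - Real.log (ρ' (j + 1) U)) * ρ' (j + 1) U ∂(σ V)) / (∫ U, sfCut (θBal F.L γ b₀ p₀ (j + 1)) U * ρ' (j + 1) U ∂(σ V))) → ∀ (c : Plaq (F.P (j + 1)) 0 → ℝ) (a w : ℝ), 0 ≤ a → 0 ≤ w → a + θ / (((F.L : ℝ) ^ (j + 1) / γ) * θBal F.L γ b₀ p₀ (j + 1) ^ 2) * w ≤ w₀ → ((∀ p, |c p| ≤ a) ∧ (∀ (b b' : PBond (F.P (j + 1)) 0) U V W Z, PlaqSmall (θBal F.L γ b₀ p₀ (j + 1)) U → PlaqSmall (θBal F.L γ b₀ p₀ (j + 1)) V → PlaqSmall (θBal F.L γ b₀ p₀ (j + 1)) W → PlaqSmall (θBal F.L γ b₀ p₀ (j + 1)) Z → (∀ e, e ≠ b → U e = V e) → (∀ e, e ≠ b' → U e = W e) → (∀ e, e ≠ b' → V e = Z e) → (∀ e, e ≠ b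 → W e = Z e) → |(Real.log (ρ (j + 1) U) - Real.log (ρ' (j + 1) U) - ((F.L : ℝ) ^ (j + 1) / γ) * ∑ p, c p * (1 - reTr (GaugeField.plaqHol U p))) - (Real.log (ρ (j + 1) V) - Real.log (ρ' (j + 1) V) - ((F.L : ℝ) ^ (j + 1) / γ) * ∑ p, c p * (1 - reTr (GaugeField.plaqHol V p))) - ((Real.log (ρ (j + 1) W) - Real.log (ρ' (j + 1) W) - ((F.L : ℝ) ^ (j + 1) / γ) * ∑ p, c p * (1 - reTr (GaugeField.plaqHol W p))) - (Real.log (ρ (j + 1) Z) - Real.log (ρ' (j + 1) Z) - ((F.L : ℝ) ^ (j + 1) / γ) * ∑ p, c p * (1 - reTr (GaugeField.plaqHol Z p))))| ≤ w * Real.exp (-(κ * (b.src.tdist b'.src : ℝ))))) → ∃ (w' : ℝ), 0 ≤ w' ∧ θ / (((F.L : ℝ) ^ j / γ) * θBal F.L γ b₀ p₀ j ^ 2) * w' ≤ C * (a + θ / (((F.L : ℝ) ^ (j + 1) / γ) * θBal F.L γ b₀ p₀ (j + 1) ^ 2) * w) * (a + θ / (((F.L : ℝ) ^ (j + 1) /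 γ) * θBal F.L γ b₀ p₀ (j + 1) ^ 2) * w) + δ j ∧ (∀ (b b' : PBond (F.P j) 0) U V W Z, PlaqSmall (θBal F.L γ b₀ p₀ j) U → PlaqSmall (θBal F.L γ b₀ p₀ j) V → PlaqSmall (θBal F.L γ b₀ p₀ j) W → PlaqSmall (θBal F.L γ b₀ p₀ j) Z → (∀ e, e ≠ b → U e = V e) → (∀ e, e ≠ b' → U e = W e) → (∀ e, e ≠ b' → V e = Z e) → (∀ e, e ≠ b → W e = Z e) → |(Real.log (ρ j U) - Real.log (ρ' j U) - m U) - (Real.log (ρ j V) - Real.log (ρ' j V) - m V) - ((Real.log (ρ j W) - Real.log (ρ' j W) - m W) - (Real.log (ρ j Z) - Real.log (ρ' j Z) - m Z))| ≤ w' * Real.exp (-(κ * (b.src.tdist b'.src : ℝ))))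

/-- SFC∘ · SMALL-FIELD CUMULANT (row 1; size L — cumulants of the localised fibre law).  In JEN∘'s frame: there is a window-continuous
`qs` (a version of `q_sf(V) = log ∫χρ_{j+1}dσ_V − log ∫χρ′_{j+1}dσ_V − m(V) = log Ẽ_V[e^{h − m(V)}]`, a.e. on the window) and a weight
`w′ ≥ 0` with `Θ_j w′ ≤ C·x·x + δ_j` and the 4-point window clause for `qs`.  Mechanism: centred cumulant generating function of
`f = h − m(V)` under the localised reference fibre law (`Ẽ_V f = 0` by the definition of `m`): quadratic in the local size of `f`,
clustered by the decay of the small-field fluctuation covariance; the continuous version is `log ∫χρ dλ_V − log ∫χρ′ dλ_V − m` over the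
regular fibre package `λ` of «version_coarea» (`φ` cancels).
Why it might fail: the `Θ_j`-weighted 4-point size of a second cumulant must be `≤ C·x²` with `x = a + Θ_{j+1}w` — the marginal amplitude
`a` enters `f` through `β_{j+1}θ_{j+1}²`-sized local oscillations on the fine window, and `β_jθ_j² = b₀²(1 + log g_j⁻¹)^{2p₀}` grows
(logarithmically) in `j`, so `C` uniform in `j ≥ j₁(θ)` is a genuine bet (the same bet JEN∘ makes; the floor `δ_j` absorbs nothing of it);
the localised law `Ẽ_V` is not log-concave at the cutoff's shoulder, so Brascamp–Lieb applies to the convex core only and the shoulder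
must be handled by the cluster expansion.
Sources: [Balaban1985UV3] (41)–(47); [Balaban1985Propagators] (decay of the fluctuation covariance); [Balaban1988RG2] §1; Brascamp–Lieb, J. Funct.
Anal. 22 (1976) (as cited in [corpus:paper:arxiv-1311.4118 p.7], [corpus:paper:arxiv-1710.08106 p.3]); Herbst's argument — Ledoux, The Concentration of
Measure Phenomenon, AMS Surveys 89 [galaxy:pdf:-1602980643149203940]; small∕large-field expansions [corpus:book:rivasseau1991-from-perturbative-constructive-renormalization p.258, 289]. -/
def SmallFieldCumulantCan : Prop :=
  ∃ γ₁ : ℝ, 0 < γ₁ ∧ ∀ (F : T3Family) (γ : ℝ), 0 < γ → γ ≤ γ₁ → ∀ (b₀ p₀ : ℝ) (j₀ : ℕ) (prm : ℕ → ClassParams) (η : ℕ → ℝ), 0 < b₀ → 0 < p₀ → AdmissibleClassParams F γ b₀ p₀ prm → (∀ j, 0 ≤ η j) → Summable η → Summable (fun i => ∑' k, η (k + i)) → Tendsto (fun j => (∑' k, η (k + j)) * ((1 + 2 * ((F.L : ℝ) ^ j / γ) * (Fintype.card (Plaq (F.P j) 0) : ℝ)) * (Fintype.card (PBond (F.P j)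 0) : ℝ) ^ 2)) atTop (𝓝 0) → ∃ κ₀ : ℝ, 0 < κ₀ ∧ ∀ (κ : ℝ), 0 < κ → κ ≤ κ₀ → ∃ θ₀ : ℝ, 0 < θ₀ ∧ ∀ (θ : ℝ), 0 < θ → θ ≤ θ₀ → ∃ (C w₀ : ℝ) (δ : ℕ → ℝ) (j₁ : ℕ), 0 ≤ C ∧ 0 < w₀ ∧ (∀ j, 0 ≤ δ j) ∧ Summable δ ∧ Summable (fun i => ∑' k, δ (k + i)) ∧ Tendsto (fun j => (∑' k, δ (k + j)) * ((1 + 2 * ((F.L : ℝ) ^ j / γ) * (Fintype.card (Plaq (F.P j) 0) : ℝ)) * (Fintype.card (PBond (F.P j) 0) : ℝ) ^ 2)) atTop (𝓝 0) ∧ j₀ ≤ j₁ ∧ ∀ (T : ℕ), ∀ (μ μ' : ((j : ℕ) → MeasureTheory.Measure (GaugeField (F.P j) 0 ↥(Matrix.specialUnitaryGroup (Fin 2) ℂ)))) (ρ ρ' : ((j : ℕ) → GaugeField (F.P j) 0 ↥(Matrix.specialUnitaryGroup (Fin 2) ℂ) → ℝ)), (∀ j : ℕ, j ≤ T → IsProbabilityMeasure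 (μ j) ∧ IsProbabilityMeasure (μ' j)) → (∀ j : ℕ, j < T → μ j = Measure.map (descend F ℰp j) (μ (j + 1)) ∧ μ' j = Measure.map (descend F ℰp j) (μ' (j + 1))) → (∀ j : ℕ, j₀ ≤ j → j ≤ T → ((∀ U, PlaqSmall (θBal F.L γ b₀ p₀ j) U → 0 < ρ j U ∧ 0 < ρ' j U) ∧ μ j = (fieldMeasure _ _ _).withDensity (fun U => ENNReal.ofReal (ρ j U)) ∧ μ' j = (fieldMeasure _ _ _).withDensity (fun U => ENNReal.ofReal (ρ' j U)) ∧ MemAtHeight F ℰp j (prm j) (ρ j) ∧ MemAtHeight F ℰp j (prm j) (ρ' j) ∧ μ j {U | ¬ PlaqSmall (θBal F.L γ b₀ p₀ j) U} ≤ ENNReal.ofReal (η j) ∧ μ' j {U | ¬ PlaqSmall (θBal F.L γ b₀ p₀ j) U} ≤ ENNReal.ofReal (η j) ∧ (ContinuousOn (ρ j) {U | PlaqSmall (θBal F.L γ b₀ p₀ j) U} ∧ ContinuousOn (ρ' j) {U | PlaqSmall (θBal F.L γ b₀ p₀ j) U}))) → ∀ (j : ℕ), j₁ ≤ j → j + 2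 ≤ T → ∀ (σ : ProbabilityTheory.Kernel (GaugeField (F.P j) 0 ↥(Matrix.specialUnitaryGroup (Fin 2) ℂ)) (GaugeField (F.P (j + 1)) 0 ↥(Matrix.specialUnitaryGroup (Fin 2) ℂ))), ProbabilityTheory.IsMarkovKernel σ → (Measure.map (descend F ℰp j) (fieldMeasure (F.P (j + 1)) 0 ↥(Matrix.specialUnitaryGroup (Fin 2) ℂ))).bind ⇑σ = fieldMeasure (F.P (j + 1)) 0 ↥(Matrix.specialUnitaryGroup (Fin 2) ℂ) → (∀ᵐ V ∂(Measure.map (descend F ℰp j) (fieldMeasure (F.P (j + 1)) 0 ↥(Matrix.specialUnitaryGroup (Fin 2) ℂ))), ∀ᵐ U ∂(σ V), descend F ℰp j U = V) → ∀ (m : GaugeField (F.P j) 0 ↥(Matrix.specialUnitaryGroup (Fin 2) ℂ) → ℝ), ContinuousOn m {V | PlaqSmall (θBal F.L γ b₀ p₀ j) V} → (∀ᵐ V ∂(fieldMeasure (F.P j) 0 ↥(Matrix.specialUnitaryGroup (Fin 2) ℂ)), PlaqSmall (θBal F.L γ b₀ p₀ j) V → MeasureTheory.Integrable (fun U => sfCut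 (θBal F.L γ b₀ p₀ (j + 1)) U * (Real.log (ρ (j + 1) U) - Real.log (ρ' (j + 1) U)) * ρ' (j + 1) U) (σ V) ∧ m V = (∫ U, sfCut (θBal F.L γ b₀ p₀ (j + 1)) U * (Real.log (ρ (j + 1) U) - Real.log (ρ' (j + 1) U)) * ρ' (j + 1) U ∂(σ V)) / (∫ U, sfCut (θBal F.L γ b₀ p₀ (j + 1)) U * ρ' (j + 1) U ∂(σ V))) → ∀ (c : Plaq (F.P (j + 1)) 0 → ℝ) (a w : ℝ), 0 ≤ a → 0 ≤ w → a + θ / (((F.L : ℝ) ^ (j + 1) / γ) * θBal F.L γ b₀ p₀ (j + 1) ^ 2) * w ≤ w₀ → ((∀ p, |c p| ≤ a) ∧ (∀ (b b' : PBond (F.P (j + 1)) 0) U V W Z, PlaqSmall (θBal F.L γ b₀ p₀ (j + 1)) U → PlaqSmall (θBal F.L γ b₀ p₀ (j + 1)) V → PlaqSmall (θBal F.L γ b₀ p₀ (j + 1)) W → PlaqSmall (θBal F.L γ b₀ p₀ (j + 1)) Z → (∀ e, e ≠ b → U e = V e) → (∀ e, e ≠ b' → U e = W e) → (∀ e, e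 ≠ b' → V e = Z e) → (∀ e, e ≠ b → W e = Z e) → |(Real.log (ρ (j + 1) U) - Real.log (ρ' (j + 1) U) - ((F.L : ℝ) ^ (j + 1) / γ) * ∑ p, c p * (1 - reTr (GaugeField.plaqHol U p))) - (Real.log (ρ (j + 1) V) - Real.log (ρ' (j + 1) V) - ((F.L : ℝ) ^ (j + 1) / γ) * ∑ p, c p * (1 - reTr (GaugeField.plaqHol V p))) - ((Real.log (ρ (j + 1) W) - Real.log (ρ' (j + 1) W) - ((F.L : ℝ) ^ (j + 1) / γ) * ∑ p, c p * (1 - reTr (GaugeField.plaqHol W p))) - (Real.log (ρ (j + 1) Z) - Real.log (ρ' (j + 1) Z) - ((F.L : ℝ) ^ (j + 1) / γ) * ∑ p, c p * (1 - reTr (GaugeField.plaqHol Z p))))| ≤ w * Real.exp (-(κ * (b.src.tdist b'.src : ℝ))))) → ∃ (qs : GaugeField (F.P j) 0 ↥(Matrix.specialUnitaryGroup (Fin 2) ℂ) → ℝ) (w' : ℝ), ContinuousOn qs {V | PlaqSmall (θBal F.L γ b₀ p₀ j) V} ∧ (∀ᵐ U ∂(fieldMeasure (F.P j) 0 ↥(Matrix.specialUnitaryGroup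 (Fin 2) ℂ)), PlaqSmall (θBal F.L γ b₀ p₀ j) U → qs U = Real.log (∫ Y, sfCut (θBal F.L γ b₀ p₀ (j + 1)) Y * ρ (j + 1) Y ∂(σ U)) - Real.log (∫ Y, sfCut (θBal F.L γ b₀ p₀ (j + 1)) Y * ρ' (j + 1) Y ∂(σ U)) - m U) ∧ 0 ≤ w' ∧ θ / (((F.L : ℝ) ^ j / γ) * θBal F.L γ b₀ p₀ j ^ 2) * w' ≤ C * (a + θ / (((F.L : ℝ) ^ (j + 1) / γ) * θBal F.L γ b₀ p₀ (j + 1) ^ 2) * w) * (a + θ / (((F.L : ℝ) ^ (j + 1) / γ) * θBal F.L γ b₀ p₀ (j + 1) ^ 2) * w) + δ j ∧ (∀ (b b' : PBond (F.P j) 0) U V W Z, PlaqSmall (θBal F.L γ b₀ p₀ j) U → PlaqSmall (θBal F.L γ b₀ p₀ j) V → PlaqSmall (θBal F.L γ b₀ p₀ j) W → PlaqSmall (θBal F.L γ b₀ p₀ j) Z → (∀ e, e ≠ b → U e = V e) → (∀ e, e ≠ b' → U e = W e) → (∀ e, e ≠ b' → V e = Z e) → (∀ e, e ≠ b → W e =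 Z e) → |qs U - qs V - (qs W - qs Z)| ≤ w' * Real.exp (-(κ * (b.src.tdist b'.src : ℝ))))

/-- COLLAR∘ · COLLAR ∕ LARGE-FIELD CONDITIONAL-MASS LOG-RATIO (row 2; size M–L — large-field suppression, fibrewise).  In JEN∘'s frame,
for ANY window-continuous `qs` a.e. equal to the `σ`-expression of `q_sf`: the difference `q − qs` (a.e. `= log E′[χ | V] − log E[χ | V]`
by the fibre identity — the log-ratio of the two towers' conditional small-field probabilities over `V`) has a 4-point window weight `w′`
with `Θ_j w′ ≤ C·x·x + δ_j` (intended `C = 0`: FLOOR size).  Mechanism: `1 − E[χ | V]`, `1 − E′[χ | V]` are conditional masses of the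
collar `{θ_{j+1}/2 < max defect}` ∩ window (Wilson weight `exp(−β_{j+1}θ_{j+1}²(1 − cos)/…)`, i.e. `exp(−c·b₀²(1 + log g⁻¹)^{2p₀})`,
summable in `j` for `p₀ > 1/2`) and of the large-field region (`Mem.large`: the class's `p₀`-suppression), for both towers, uniformly in
the window datum `V`; a log-ratio of two numbers in `[1 − δ, 1]` has absolute size `≤ 2δ`, and its 4-point differences inherit the
locality of the conditional masses (polymer expansion of the large-field region, [Balaban1988LargeField]).
Why it might fail: the floor class of O1 (`δ` summable with the `(1 + 2β_j|Plaq|)|PBond|²`-weighted tails → 0) was sized for TOTAL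
large-field masses `η_j`; CONDITIONAL masses over a window datum are controlled by the class only through `Mem.large`'s pointwise upper
bound, which must hold uniformly along fibres — if `Mem.large` is stated in the mean (not pointwise), COLLAR∘ is false as typed for a
member concentrating its large-field mass over a thin set of window data (census D25-4's mass-moving trick, now on `1 − χ` instead of `h`).
Sources: [Balaban1985UV3] (47) p.267; [Balaban1988LargeField] §1–2; `BalabanUVClass.Mem` (tree, the `large` ∕ `nonneg` fields). -/
def CollarMassCan : Prop :=
  ∃ γ₁ : ℝ, 0 < γ₁ ∧ ∀ (F : T3Family) (γ : ℝ), 0 < γ → γ ≤ γ₁ → ∀ (b₀ p₀ : ℝ) (j₀ : ℕ) (prm : ℕ → ClassParams) (η : ℕ → ℝ), 0 < b₀ → 0 < p₀ → AdmissibleClassParams F γ b₀ p₀ prm → (∀ j, 0 ≤ η j) → Summable η → Summable (fun i => ∑' k, η (k + i)) → Tendsto (fun j => (∑' k, η (k + j)) * ((1 + 2 * ((F.L : ℝ) ^ j / γ) * (Fintype.card (Plaq (F.P j) 0) : ℝ)) * (Fintype.card (PBond (F.P j) 0) : ℝ) ^ 2)) atTop (𝓝 0) → ∃ κ₀ : ℝ,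 0 < κ₀ ∧ ∀ (κ : ℝ), 0 < κ → κ ≤ κ₀ → ∃ θ₀ : ℝ, 0 < θ₀ ∧ ∀ (θ : ℝ), 0 < θ → θ ≤ θ₀ → ∃ (C w₀ : ℝ) (δ : ℕ → ℝ) (j₁ : ℕ), 0 ≤ C ∧ 0 < w₀ ∧ (∀ j, 0 ≤ δ j) ∧ Summable δ ∧ Summable (fun i => ∑' k, δ (k + i)) ∧ Tendsto (fun j => (∑' k, δ (k + j)) * ((1 + 2 * ((F.L : ℝ) ^ j / γ) * (Fintype.card (Plaq (F.P j) 0) : ℝ)) * (Fintype.card (PBond (F.P j) 0) : ℝ) ^ 2)) atTop (𝓝 0) ∧ j₀ ≤ j₁ ∧ ∀ (T : ℕ), ∀ (μ μ' : ((j : ℕ) → MeasureTheory.Measure (GaugeField (F.P j) 0 ↥(Matrix.specialUnitaryGroup (Fin 2) ℂ)))) (ρ ρ' : ((j : ℕ) → GaugeField (F.P j) 0 ↥(Matrix.specialUnitaryGroup (Fin 2) ℂ) → ℝ)), (∀ j : ℕ, j ≤ T → IsProbabilityMeasure (μ j) ∧ IsProbabilityMeasure (μ' j)) → (∀ j : ℕ,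 j < T → μ j = Measure.map (descend F ℰp j) (μ (j + 1)) ∧ μ' j = Measure.map (descend F ℰp j) (μ' (j + 1))) → (∀ j : ℕ, j₀ ≤ j → j ≤ T → ((∀ U, PlaqSmall (θBal F.L γ b₀ p₀ j) U → 0 < ρ j U ∧ 0 < ρ' j U) ∧ μ j = (fieldMeasure _ _ _).withDensity (fun U => ENNReal.ofReal (ρ j U)) ∧ μ' j = (fieldMeasure _ _ _).withDensity (fun U => ENNReal.ofReal (ρ' j U)) ∧ MemAtHeight F ℰp j (prm j) (ρ j) ∧ MemAtHeight F ℰp j (prm j) (ρ' j) ∧ μ j {U | ¬ PlaqSmall (θBal F.L γ b₀ p₀ j) U} ≤ ENNReal.ofReal (η j) ∧ μ' j {U | ¬ PlaqSmall (θBal F.L γ b₀ p₀ j) U} ≤ ENNReal.ofReal (η j) ∧ (ContinuousOn (ρ j) {U | PlaqSmall (θBal F.L γ b₀ p₀ j) U} ∧ ContinuousOn (ρ' j) {U | PlaqSmall (θBal F.L γ b₀ p₀ j) U}))) → ∀ (j : ℕ), j₁ ≤ j → j + 2 ≤ T → ∀ (σ : ProbabilityTheory.Kernel (GaugeField (F.P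 j) 0 ↥(Matrix.specialUnitaryGroup (Fin 2) ℂ)) (GaugeField (F.P (j + 1)) 0 ↥(Matrix.specialUnitaryGroup (Fin 2) ℂ))), ProbabilityTheory.IsMarkovKernel σ → (Measure.map (descend F ℰp j) (fieldMeasure (F.P (j + 1)) 0 ↥(Matrix.specialUnitaryGroup (Fin 2) ℂ))).bind ⇑σ = fieldMeasure (F.P (j + 1)) 0 ↥(Matrix.specialUnitaryGroup (Fin 2) ℂ) → (∀ᵐ V ∂(Measure.map (descend F ℰp j) (fieldMeasure (F.P (j + 1)) 0 ↥(Matrix.specialUnitaryGroup (Fin 2) ℂ))), ∀ᵐ U ∂(σ V), descend F ℰp j U = V) → ∀ (m : GaugeField (F.P j) 0 ↥(Matrix.specialUnitaryGroup (Fin 2) ℂ) → ℝ), ContinuousOn m {V | PlaqSmall (θBal F.L γ b₀ p₀ j) V} → (∀ᵐ V ∂(fieldMeasure (F.P j) 0 ↥(Matrix.specialUnitaryGroup (Fin 2) ℂ)), PlaqSmall (θBal F.L γ b₀ p₀ j) V → MeasureTheory.Integrable (fun U => sfCut (θBal F.L γ b₀ p₀ (j + 1)) U * (Real.log (ρ (j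 + 1) U) - Real.log (ρ' (j + 1) U)) * ρ' (j + 1) U) (σ V) ∧ m V = (∫ U, sfCut (θBal F.L γ b₀ p₀ (j + 1)) U * (Real.log (ρ (j + 1) U) - Real.log (ρ' (j + 1) U)) * ρ' (j + 1) U ∂(σ V)) / (∫ U, sfCut (θBal F.L γ b₀ p₀ (j + 1)) U * ρ' (j + 1) U ∂(σ V))) → ∀ (c : Plaq (F.P (j + 1)) 0 → ℝ) (a w : ℝ), 0 ≤ a → 0 ≤ w → a + θ / (((F.L : ℝ) ^ (j + 1) / γ) * θBal F.L γ b₀ p₀ (j + 1) ^ 2) * w ≤ w₀ → ((∀ p, |c p| ≤ a) ∧ (∀ (b b' : PBond (F.P (j + 1)) 0) U V W Z, PlaqSmall (θBal F.L γ b₀ p₀ (j + 1)) U → PlaqSmall (θBal F.L γ b₀ p₀ (j + 1)) V → PlaqSmall (θBal F.L γ b₀ p₀ (j + 1)) W → PlaqSmall (θBal F.L γ b₀ p₀ (j + 1)) Z → (∀ e, e ≠ b → U e = V e) → (∀ e, e ≠ b' → U e = W e) → (∀ e, e ≠ b' → V e = Z e) → (∀ e, e ≠ b → W e = Z e) → |(Real.log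 (ρ (j + 1) U) - Real.log (ρ' (j + 1) U) - ((F.L : ℝ) ^ (j + 1) / γ) * ∑ p, c p * (1 - reTr (GaugeField.plaqHol U p))) - (Real.log (ρ (j + 1) V) - Real.log (ρ' (j + 1) V) - ((F.L : ℝ) ^ (j + 1) / γ) * ∑ p, c p * (1 - reTr (GaugeField.plaqHol V p))) - ((Real.log (ρ (j + 1) W) - Real.log (ρ' (j + 1) W) - ((F.L : ℝ) ^ (j + 1) / γ) * ∑ p, c p * (1 - reTr (GaugeField.plaqHol W p))) - (Real.log (ρ (j + 1) Z) - Real.log (ρ' (j + 1) Z) - ((F.L : ℝ) ^ (j + 1) / γ) * ∑ p, c p * (1 - reTr (GaugeField.plaqHol Z p))))| ≤ w * Real.exp (-(κ * (b.src.tdist b'.src : ℝ))))) → ∀ (qs : GaugeField (F.P j) 0 ↥(Matrix.specialUnitaryGroup (Fin 2) ℂ) → ℝ), ContinuousOn qs {V | PlaqSmall (θBal F.L γ b₀ p₀ j) V} → (∀ᵐ U ∂(fieldMeasure (F.P j) 0 ↥(Matrix.specialUnitaryGroup (Fin 2) ℂ)), PlaqSmall (θBal F.L γ b₀ p₀ j)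 U → qs U = Real.log (∫ Y, sfCut (θBal F.L γ b₀ p₀ (j + 1)) Y * ρ (j + 1) Y ∂(σ U)) - Real.log (∫ Y, sfCut (θBal F.L γ b₀ p₀ (j + 1)) Y * ρ' (j + 1) Y ∂(σ U)) - m U) → ∃ (w' : ℝ), 0 ≤ w' ∧ θ / (((F.L : ℝ) ^ j / γ) * θBal F.L γ b₀ p₀ j ^ 2) * w' ≤ C * (a + θ / (((F.L : ℝ) ^ (j + 1) / γ) * θBal F.L γ b₀ p₀ (j + 1) ^ 2) * w) * (a + θ / (((F.L : ℝ) ^ (j + 1) / γ) * θBal F.L γ b₀ p₀ (j + 1) ^ 2) * w) + δ j ∧ (∀ (b b' : PBond (F.P j) 0) U V W Z, PlaqSmall (θBal F.L γ b₀ p₀ j) U → PlaqSmall (θBal F.L γ b₀ p₀ j) V → PlaqSmall (θBal F.L γ b₀ p₀ j) W → PlaqSmall (θBal F.L γ b₀ p₀ j) Z → (∀ e, e ≠ b → U e = V e) → (∀ e, e ≠ b' → U e = W e) → (∀ e, e ≠ b' → V e = Z e) → (∀ e, e ≠ b → W e = Z e) → |((Real.log (ρ j U) - Real.log (ρ' j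 U) - m U) - qs U) - ((Real.log (ρ j V) - Real.log (ρ' j V) - m V) - qs V) - (((Real.log (ρ j W) - Real.log (ρ' j W) - m W) - qs W) - ((Real.log (ρ j Z) - Real.log (ρ' j Z) - m Z) - qs Z))| ≤ w' * Real.exp (-(κ * (b.src.tdist b'.src : ℝ))))

/-- stub · SFC∘ (row 1). -/
theorem stub_smallFieldCumulant : SmallFieldCumulantCan := by
  sorry

/-- stub · COLLAR∘ (row 2). -/
theorem stub_collarMass : CollarMassCan := by
  sorry

/-- ★ JUNCTION (kernel-checked, no sorry): `q = qs + (q − qs)`; `γ₁ κ₀ θ₀ w₀ := min`, `C := Cˢ + Cᶜ`, `δ := δˢ + δᶜ` (floor class closed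
under `+`), `j₁ := max`, `w′ := w₁ + w₂`; the 4-point clause by `|A| = |B + (A − B)| ≤ |B| + |A − B|`. -/
theorem jensenGap_of_collarCut
    (hS : SmallFieldCumulantCan) (hK : CollarMassCan) : JensenGapCan := by
  obtain ⟨γS, hγS, hS⟩ := hS
  obtain ⟨γK, hγK, hK⟩ := hK
  refine ⟨min γS γK, lt_min hγS hγK, ?_⟩
  intro F γ hγ hγ1 b₀ p₀ j₀ prm η hb₀ hp₀ hadm hη0 hηs hηss hηt
  obtain ⟨κS, hκS, hS⟩ := hS F γ hγ (hγ1.trans (min_le_left _ _)) b₀ p₀ j₀ prm η hb₀ hp₀ hadm hη0 hηs hηss hηt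
  obtain ⟨κK, hκK, hK⟩ := hK F γ hγ (hγ1.trans (min_le_right _ _)) b₀ p₀ j₀ prm η hb₀ hp₀ hadm hη0 hηs hηss hηt
  refine ⟨min κS κK, lt_min hκS hκK, ?_⟩
  intro κ hκ hκle
  obtain ⟨θS, hθS, hS⟩ := hS κ hκ (hκle.trans (min_le_left _ _))
  obtain ⟨θK, hθK, hK⟩ := hK κ hκ (hκle.trans (min_le_right _ _))
  refine ⟨min θS θK, lt_min hθS hθK, ?_⟩
  intro θ hθ hθle
  obtain ⟨CS, wS, δS, jS, hCS, hwS, hnnS, hδSs, hδSss, hδSt, hjS, hS⟩ := hS θ hθ (hθle.trans (min_le_left _ _))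
  obtain ⟨CK, wK, δK, jK, hCK, hwK, hnnK, hδKs, hδKss, hδKt, hjK, hK⟩ := hK θ hθ (hθle.trans (min_le_right _ _))
  have h1 : ∀ i, Summable (fun k => δS (k + i)) := fun i => (summable_nat_add_iff i).mpr hδSs
  have h2 : ∀ i, Summable (fun k => δK (k + i)) := fun i => (summable_nat_add_iff i).mpr hδKs
  refine ⟨CS + CK, min wS wK, fun j => δS j + δK j, max jS jK, add_nonneg hCS hCK, lt_min hwS hwK,
    fun j => add_nonneg (hnnS j) (hnnK j), hδSs.add hδKs, ?_, ?_, hjS.trans (le_max_left _ _), ?_⟩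
  · have key : (fun i => ∑' k, (δS (k + i) + δK (k + i))) =
        fun i => (∑' k, δS (k + i)) + ∑' k, δK (k + i) := by
      funext i
      exact (h1 i).tsum_add (h2 i)
    rw [key]
    exact hδSss.add hδKss
  · have key : (fun j => (∑' k, (δS (k + j) + δK (k + j))) * ((1 + 2 * ((F.L : ℝ) ^ j / γ) * (Fintype.card (Plaq (F.P j) 0) : ℝ)) * (Fintype.card (PBond (F.P j) 0) : ℝ) ^ 2)) =
        fun j => (∑' k, δS (k + j)) * ((1 + 2 * ((F.L : ℝ) ^ j / γ) * (Fintype.card (Plaq (F.P j) 0) : ℝ)) * (Fintype.card (PBond (F.P j) 0) : ℝ) ^ 2) +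
          (∑' k, δK (k + j)) * ((1 + 2 * ((F.L : ℝ) ^ j / γ) * (Fintype.card (Plaq (F.P j) 0) : ℝ)) * (Fintype.card (PBond (F.P j) 0) : ℝ) ^ 2) := by
      funext j
      rw [(h1 j).tsum_add (h2 j), add_mul]
    rw [key]
    simpa using hδSt.add hδKt
  · intro T μ μ' ρ ρ' hprob hcons hwin j hj hjT σ hσM hσb hσf m hmc hmae c a w ha hw hx hin
    obtain ⟨qs, w₁, hqc, hqae, hw₁, hbdS, h4S⟩ :=
      hS T μ μ' ρ ρ' hprob hcons hwin j ((le_max_left _ _).trans hj) hjT σ hσM hσb hσf m hmc hmae c a w ha hw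
        (hx.trans (min_le_left _ _)) hin
    obtain ⟨w₂, hw₂, hbdK, h4K⟩ :=
      hK T μ μ' ρ ρ' hprob hcons hwin j ((le_max_right _ _).trans hj) hjT σ hσM hσb hσf m hmc hmae c a w ha hw
        (hx.trans (min_le_right _ _)) hin qs hqc hqae
    refine ⟨w₁ + w₂, add_nonneg hw₁ hw₂, ?_, ?_⟩
    · beta_reduce
      linear_combination hbdS + hbdK
    · intro b b' U V W Z hU hV' hW hZ e1 e2 e3 e4
      have A := h4S b b' U V W Z hU hV' hW hZ e1 e2 e3 e4
      have B := h4K b b' U V W Z hU hV' hW hZ e1 e2 e3 e4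
      have hsum := add_le_add A B
      rw [← add_mul] at hsum
      refine le_trans ?_ hsum
      refine le_trans (le_of_eq ?_) (abs_add_le _ _)
      congr 1
      ring

/-- plug: JEN∘ from the two stubs (what `OrganTangent.stub_jensenGap` would be replaced by, text-identically). -/
theorem jensenGap_of_stubs : JensenGapCan :=
  jensenGap_of_collarCut stub_smallFieldCumulant stub_collarMass

end Summit.QuantumFields.YangMills.Cruxes.FluctuationComparisonRegPrIntL.JensenCollar
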